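import Summits.BirchSwinnertonDyer.BirchSwinnertonDyer.Theorems.ThetaPartnerAtTwoMazurTateCongruenceAtTwoROfLambda
import Summits.BirchSwinnertonDyer.BirchSwinnertonDyer.Theorems.ThetaPartnerAtTwoMazurTateCongruenceAtTwoRLayerToLambda
import Summits.BirchSwinnertonDyer.BirchSwinnertonDyer.Theorems.ThetaPartnerAtTwoMazurTateCongruenceAtTwoREulerCongruence
import Summits.BirchSwinnertonDyer.BirchSwinnertonDyer.Theorems.ThetaPartnerAtTwoMazurTateCongruenceAtTwoRCensusLayer
import Summits.BirchSwinnertonDyer.BirchSwinnertonDyer.Theorems.ByReductionTypeAtTwoSupersingularMazurTateReading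
import HarnessLib
-- buildfix (bf3-g30) G30-18: comment-only touch to re-dispatch the lane build (dead-lettered rc 76 ×7 behind Theorems.ByReductionTypeAtTwoSupersingularThetaHabitat, which bf3-g29 re-glued p635943 (hub olean 13:14); no build event since 12:21; operator express ask 14:2x unserved); declarations byte-identical

/-!
# Crux `MazurTateCongruenceAtTwoTop` (stmt-BirchSwinnertonDyer-25797) = `MazurTateCongruenceAtTwoR` (21416) BY NAME:
# the NORMAL FORM — item ⟺ (GV2Λ) ⟺ [under the PUB period-unit fact at `2`] (V2♭)

Cell `bsd-wall`, seat `bsd-wall-tp2-p1-w2` (WIDTH seat on the K1 row of route `ThetaPartnerAtTwo`). THEOREMS ONLY (no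
`def`, no named fact, no `sorry`). Leaf file (imports the route file through `…OfLambda`; nothing builds on it).

The crux (oriented `S₀`-depleted Mazur–Tate congruence at EVERY even layer, ONE unit `u`, for every admissible integral
multiple `ι G = 2^m ϖ ι L♭`, `ι G_A = 2^{m'} ϖ_A ι L♭_A`) is put in normal form by the route-independent cores
`…MazurTateCongruenceAtTwoRIntegrality` (integrality transfer through Pollack's congruence), `…OfLambda` (Λ ⟹ layers) and
`…LayerToLambda` (layers ⟹ Λ; period-unit reduction):

* `lambdaCongruence_of_mazurTateCongruenceAtTwoR`, `mazurTateCongruenceAtTwoR_iff_lambdaCongruence`: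
  **item ⟺ (GV2Λ)** := same binders, conclusion `∃ u ∈ ℤ₂ˣ, 2^{m'} G E_{S₀}(W) − u 2^m G_A E_{S₀}(A) ∈ 2^{m+m'+1}Λ`
  (Greenberg–Vatsal 2000 (13) / Vatsal 1999 (1.10) READ AT `2` for the Néron-normalised `S₀`-depleted Kobayashi-plus
  `2`-adic `L`-functions; no layer, no parity of `n`, the SAME `u`);
* `mazurTateCongruenceAtTwoR_of_periodUnit_of_flatCongruence`, `flatCongruence_of_periodUnit_of_mazurTateCongruenceAtTwoR`,
  `mazurTateCongruenceAtTwoR_iff_flatCongruence`: GRANTED the printed period comparison at `2`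
  (`realPeriodRat_eq_unit_mul_plusPeriod_two`: `Ω_W = u·Ω⁺_f`, `|u|₂ = 1` for `W` good at `2` with `W[2]` irreducible —
  Greenberg–Vatsal Rem. (3.4) via Edixhoven + Abbes–Ullmo; both curves of a theta pair are good supersingular at `2`, so
  `|ϖ|₂ = |ϖ_A|₂ = 1`, `SSMazurTate.norm_periodRatio_eq_one_two`), **item ⟺ (V2♭)** := for every theta pair, newforms
  `f, f_A`, Pollack pairs at `2` and admissible `S₀`: `∃ u ∈ ℤ₂ˣ, L♭_W · E_{S₀}(W) − u · L♭_A · E_{S₀}(A) ∈ 2Λ`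
  (`L♭ = kobayashiL 1 L⁺ L⁻`, each form in its own `Ω⁺`-normalisation — NO period, NO integral multiple, NO layer).

* `mazurTateCongruenceAtTwoR_iff_sub_mem_two`: the unit `u` is inert as well (`u ≡ 1 mod 2`): **item ⟺ `L♭_W E_{S₀}(W) −
  L♭_A E_{S₀}(A) ∈ 2Λ`** for every admissible datum (and the admissible `S₀` is immaterial, `flat_congruence_iff_of_admissible`).

So the research content of the K1 row's last open crux is exactly (V2♭): the mod-`2` congruence, up to a `2`-adic unit, of
the `S₀`-depleted Kobayashi-plus `2`-adic `L`-functions of two weight-`2` newforms with isomorphic irreducible mod-`2` Galois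
representations, both supersingular at `2` with `a₂ = 0` — Vatsal 1999 Thm. (1.10) / Greenberg–Vatsal (13) at `p = 2` for
Pollack–Sprung's `L♭`, unpublished at `p = 2`. Nothing is asserted about (GV2Λ) or (V2♭). BSD is not proved by any of this.

References: R. Greenberg, V. Vatsal, Invent. Math. 142 (2000) §3, (13), Remark (3.4) [GreenbergVatsal2000]; V. Vatsal,
Duke Math. J. 98 (1999) Thm. (1.10) [Vatsal1999]; A. Abbes, E. Ullmo, Compositio Math. 103 (1996) Thm. A [AbbesUllmo1996];
R. Pollack, Duke Math. J. 118 (2003) Prop. 6.18 [Pollack2003].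
-/

set_option linter.dupNamespace false
set_option autoImplicit false

noncomputable section

open scoped Classical MatrixGroups ModularForm

open CongruenceSubgroup Polynomial WeierstrassCurve NumberField IsDedekindDomain
  Literature.NumberTheory.EllipticCurves Literature.NumberTheory.EllipticCurves.ModularForms
  Literature.NumberTheory.EllipticCurves.Rank1Residual Literature.NumberTheory.EllipticCurves.GreenbergVatsal2000
  Literature.NumberTheory.EllipticCurves.Sprung2017
  Summit.BirchSwinnertonDyer.Rank1Residual.Supersingular

namespace Summit.BirchSwinnertonDyer.BirchSwinnertonDyer.Theorems.MazurTateCongruenceAtTwoR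

section Lambda

/-- **(GV2Λ) from the crux `MazurTateCongruenceAtTwoR` (items 25797/21416), class level.** For every theta pair and every
admissible datum exactly as in the crux, the unit `u` of the crux satisfies the single congruence in `Λ`
`2^{m'} · G · E_{S₀}(W) − u · 2^m · G_A · E_{S₀}(A) ∈ 2^{m+m'+1} Λ`. [cite: GreenbergVatsal2000, §3, (13)]
[cite: Pollack2003, Prop. 6.18] -/
theorem lambdaCongruence_of_mazurTateCongruenceAtTwoR
    (hMT : Summit.BirchSwinnertonDyer.BirchSwinnertonDyer.Theses.ThetaPartnerAtTwo.MazurTateCongruenceAtTwoR) :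
    ∀ (W : WeierstrassCurve ℚ) [W.IsElliptic] [W.IsGloballyMinimal] (A : WeierstrassCurve ℚ) [A.IsElliptic]
      [A.IsGloballyMinimal], ¬ W.HasCM → W.analyticRank = 0 → GoodSS W 2 → W.frobeniusTrace 2 = 0 → A.HasCM →
      GoodSS A 2 → A.frobeniusTrace 2 = 0 →
      (∃ e : WeierstrassCurve.geomTorsion W (2 : ℤ) ≃+ WeierstrassCurve.geomTorsion A (2 : ℤ),
        ∀ (σ : Field.absoluteGaloisGroup ℚ) (P : WeierstrassCurve.geomTorsion W (2 : ℤ)), e (σ • P) = σ • e P) →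
      ∀ (γ : Field.absoluteGaloisGroup ℚ), IsCyclotomicVariable 2 γ →
      ∀ [NeZero (W.conductorNorm ℤ)] (f : CuspForm (Gamma0 (W.conductorNorm ℤ)) 2), IsNewformOf W f →
      ∀ (ϖ : ℚ), (ϖ : ℝ) * W.realPeriodRat = plusPeriod f →
      ∀ (Lplus Lminus : IwasawaAlgebra 2), IsPollackPair f 2 Lplus Lminus →
      ∀ [NeZero (A.conductorNorm ℤ)] (fA : CuspForm (Gamma0 (A.conductorNorm ℤ)) 2), IsNewformOf A fA →
      ∀ (ϖA : ℚ), (ϖA : ℝ) * A.realPeriodRat = plusPeriod fA →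
      ∀ (LplusA LminusA : IwasawaAlgebra 2), IsPollackPair fA 2 LplusA LminusA →
      ∀ (S₀ : Finset (HeightOneSpectrum (𝓞 ℚ))), (∀ v ∈ S₀, ((2 : ℕ) : 𝓞 ℚ) ∉ v.asIdeal) →
        (∀ v : HeightOneSpectrum (𝓞 ℚ), ¬ W.HasGoodReductionAt v → v ∈ S₀) →
        (∀ v : HeightOneSpectrum (𝓞 ℚ), ¬ A.HasGoodReductionAt v → v ∈ S₀) →
      ∀ (G : IwasawaAlgebra 2) (m : ℕ), iwasawaToPowerSeries 2 G =
          PowerSeries.C ((2 : ℚ_[2]) ^ m * (ϖ : ℚ_[2])) * iwasawaToPowerSeries 2 (kobayashiL 1 Lplus Lminus) →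
      ∀ (GA : IwasawaAlgebra 2) (m' : ℕ), iwasawaToPowerSeries 2 GA =
          PowerSeries.C ((2 : ℚ_[2]) ^ m' * (ϖA : ℚ_[2])) * iwasawaToPowerSeries 2 (kobayashiL 1 LplusA LminusA) →
      ∃ (u : ℤ_[2]ˣ) (q₀ : IwasawaAlgebra 2),
        PowerSeries.C ((2 : ℤ_[2]) ^ m') * G * eulerFactorProductInv W 2 S₀ -
            PowerSeries.C ((u : ℤ_[2]) * (2 : ℤ_[2]) ^ m) * GA * eulerFactorProductInv A 2 S₀ =
          PowerSeries.C ((2 : ℤ_[2]) ^ (m + m' + 1)) * q₀ := by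
  intro W _ _ A _ _ hcm hr hss ha hAcm hAss hAa he γ hγ _ f hf ϖ hϖ Lplus Lminus hPP _ fA hfA ϖA hϖA LplusA LminusA
    hPPA S₀ hS2 hSW hSA G m hG GA m' hGA
  obtain ⟨u, hu⟩ := hMT W A hcm hr hss ha hAcm hAss hAa he γ hγ f hf ϖ hϖ Lplus Lminus hPP fA hfA ϖA hϖA
    LplusA LminusA hPPA S₀ hS2 hSW hSA G m hG GA m' hGA
  obtain ⟨q₀, hq₀⟩ := lambda_congruence_two_of_layer_congruences f fA hPP hPPA hG hGA hu
  exact ⟨u, q₀, hq₀⟩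

/-- **Items 25797/21416 ⟺ (GV2Λ).** The crux `MazurTateCongruenceAtTwoR` (oriented `S₀`-depleted Mazur–Tate congruence at
EVERY even layer, one unit `u`) is EQUIVALENT to the single Iwasawa-algebra-level congruence of the Néron-normalised
`S₀`-depleted Kobayashi-plus `2`-adic `L`-functions: for every theta pair and admissible datum,
`∃ u ∈ ℤ₂ˣ, 2^{m'} · G · E_{S₀}(W) − u · 2^m · G_A · E_{S₀}(A) ∈ 2^{m+m'+1} Λ` (Greenberg–Vatsal 2000 (13) /
Vatsal 1999 (1.10) READ AT `2`). Nothing asserted about either side. [cite: GreenbergVatsal2000, §3, (13)]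
[cite: Vatsal1999, Thm. (1.10)] [cite: Pollack2003, Prop. 6.18] -/
theorem mazurTateCongruenceAtTwoR_iff_lambdaCongruence :
    Summit.BirchSwinnertonDyer.BirchSwinnertonDyer.Theses.ThetaPartnerAtTwo.MazurTateCongruenceAtTwoR ↔
    ∀ (W : WeierstrassCurve ℚ) [W.IsElliptic] [W.IsGloballyMinimal] (A : WeierstrassCurve ℚ) [A.IsElliptic]
      [A.IsGloballyMinimal], ¬ W.HasCM → W.analyticRank = 0 → GoodSS W 2 → W.frobeniusTrace 2 = 0 → A.HasCM →
      GoodSS A 2 → A.frobeniusTrace 2 = 0 →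
      (∃ e : WeierstrassCurve.geomTorsion W (2 : ℤ) ≃+ WeierstrassCurve.geomTorsion A (2 : ℤ),
        ∀ (σ : Field.absoluteGaloisGroup ℚ) (P : WeierstrassCurve.geomTorsion W (2 : ℤ)), e (σ • P) = σ • e P) →
      ∀ (γ : Field.absoluteGaloisGroup ℚ), IsCyclotomicVariable 2 γ →
      ∀ [NeZero (W.conductorNorm ℤ)] (f : CuspForm (Gamma0 (W.conductorNorm ℤ)) 2), IsNewformOf W f →
      ∀ (ϖ : ℚ), (ϖ : ℝ) * W.realPeriodRat = plusPeriod f →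
      ∀ (Lplus Lminus : IwasawaAlgebra 2), IsPollackPair f 2 Lplus Lminus →
      ∀ [NeZero (A.conductorNorm ℤ)] (fA : CuspForm (Gamma0 (A.conductorNorm ℤ)) 2), IsNewformOf A fA →
      ∀ (ϖA : ℚ), (ϖA : ℝ) * A.realPeriodRat = plusPeriod fA →
      ∀ (LplusA LminusA : IwasawaAlgebra 2), IsPollackPair fA 2 LplusA LminusA →
      ∀ (S₀ : Finset (HeightOneSpectrum (𝓞 ℚ))), (∀ v ∈ S₀, ((2 : ℕ) : 𝓞 ℚ) ∉ v.asIdeal) →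
        (∀ v : HeightOneSpectrum (𝓞 ℚ), ¬ W.HasGoodReductionAt v → v ∈ S₀) →
        (∀ v : HeightOneSpectrum (𝓞 ℚ), ¬ A.HasGoodReductionAt v → v ∈ S₀) →
      ∀ (G : IwasawaAlgebra 2) (m : ℕ), iwasawaToPowerSeries 2 G =
          PowerSeries.C ((2 : ℚ_[2]) ^ m * (ϖ : ℚ_[2])) * iwasawaToPowerSeries 2 (kobayashiL 1 Lplus Lminus) →
      ∀ (GA : IwasawaAlgebra 2) (m' : ℕ), iwasawaToPowerSeries 2 GA =
          PowerSeries.C ((2 : ℚ_[2]) ^ m' * (ϖA : ℚ_[2])) * iwasawaToPowerSeries 2 (kobayashiL 1 LplusA LminusA) →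
      ∃ (u : ℤ_[2]ˣ) (q₀ : IwasawaAlgebra 2),
        PowerSeries.C ((2 : ℤ_[2]) ^ m') * G * eulerFactorProductInv W 2 S₀ -
            PowerSeries.C ((u : ℤ_[2]) * (2 : ℤ_[2]) ^ m) * GA * eulerFactorProductInv A 2 S₀ =
          PowerSeries.C ((2 : ℤ_[2]) ^ (m + m' + 1)) * q₀ :=
  ⟨lambdaCongruence_of_mazurTateCongruenceAtTwoR, mazurTateCongruenceAtTwoR_of_lambdaCongruence⟩

end Lambda

section Flat

/-- `|u⁻¹|₂ = 1` and `u⁻¹ · (u · Ω⁺) = Ω⁺` for a rational `u` with `|u|₂ = 1`: the period ratio `ϖ = u⁻¹` produced from the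
period comparison `Ω_W = u · Ω⁺_f`. [cite: GreenbergVatsal2000, §3, Remark (3.4)] -/
theorem norm_inv_eq_one_and_inv_mul_eq {u : ℚ} (hu : ‖(u : ℚ_[2])‖ = 1) {Ω P : ℝ} (hΩ : Ω = u * P) :
    ‖((u⁻¹ : ℚ) : ℚ_[2])‖ = 1 ∧ ((u⁻¹ : ℚ) : ℝ) * Ω = P := by
  have hu0 : u ≠ 0 := by
    rintro rfl
    rw [Rat.cast_zero, norm_zero] at hu
    exact zero_ne_one hu
  refine ⟨by rw [Rat.cast_inv, norm_inv, hu, inv_one], ?_⟩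
  rw [hΩ, ← mul_assoc, Rat.cast_inv, inv_mul_cancel₀ (by exact_mod_cast hu0), one_mul]

/-- **The crux `MazurTateCongruenceAtTwoR` (items 25797/21416) BY NAME from the PUB period-unit fact at `2` and the
PERIOD-FREE congruence (V2♭).** Hypotheses: `h2` = `realPeriodRat_eq_unit_mul_plusPeriod_two` (PUB, cite-only); `hV` = for
every theta pair, every cyclotomic variable, every pair of newforms with Pollack pairs at `2` and every admissible `S₀`, ONE
congruence in `Λ`: `∃ u ∈ ℤ₂ˣ, L♭_W · E_{S₀}(W) − u · L♭_A · E_{S₀}(A) ∈ 2Λ`. Conclusion: the crux. Nothing asserted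
about `hV`. [cite: GreenbergVatsal2000, §3, (13) and Remark (3.4)] [cite: AbbesUllmo1996, Thm. A]
[cite: Vatsal1999, Thm. (1.10)] [cite: Pollack2003, Prop. 6.18] -/
theorem mazurTateCongruenceAtTwoR_of_periodUnit_of_flatCongruence (h2 : realPeriodRat_eq_unit_mul_plusPeriod_two)
    (hV : ∀ (W : WeierstrassCurve ℚ) [W.IsElliptic] [W.IsGloballyMinimal] (A : WeierstrassCurve ℚ) [A.IsElliptic]
      [A.IsGloballyMinimal], ¬ W.HasCM → W.analyticRank = 0 → GoodSS W 2 → W.frobeniusTrace 2 = 0 → A.HasCM →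
      GoodSS A 2 → A.frobeniusTrace 2 = 0 →
      (∃ e : WeierstrassCurve.geomTorsion W (2 : ℤ) ≃+ WeierstrassCurve.geomTorsion A (2 : ℤ),
        ∀ (σ : Field.absoluteGaloisGroup ℚ) (P : WeierstrassCurve.geomTorsion W (2 : ℤ)), e (σ • P) = σ • e P) →
      ∀ (γ : Field.absoluteGaloisGroup ℚ), IsCyclotomicVariable 2 γ →
      ∀ [NeZero (W.conductorNorm ℤ)] (f : CuspForm (Gamma0 (W.conductorNorm ℤ)) 2), IsNewformOf W f →
      ∀ (Lplus Lminus : IwasawaAlgebra 2), IsPollackPair f 2 Lplus Lminus →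
      ∀ [NeZero (A.conductorNorm ℤ)] (fA : CuspForm (Gamma0 (A.conductorNorm ℤ)) 2), IsNewformOf A fA →
      ∀ (LplusA LminusA : IwasawaAlgebra 2), IsPollackPair fA 2 LplusA LminusA →
      ∀ (S₀ : Finset (HeightOneSpectrum (𝓞 ℚ))), (∀ v ∈ S₀, ((2 : ℕ) : 𝓞 ℚ) ∉ v.asIdeal) →
        (∀ v : HeightOneSpectrum (𝓞 ℚ), ¬ W.HasGoodReductionAt v → v ∈ S₀) →
        (∀ v : HeightOneSpectrum (𝓞 ℚ), ¬ A.HasGoodReductionAt v → v ∈ S₀) →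
      ∃ (u : ℤ_[2]ˣ) (q : IwasawaAlgebra 2),
        kobayashiL 1 Lplus Lminus * eulerFactorProductInv W 2 S₀ -
            PowerSeries.C (u : ℤ_[2]) * kobayashiL 1 LplusA LminusA * eulerFactorProductInv A 2 S₀ =
          PowerSeries.C (2 : ℤ_[2]) * q) :
    Summit.BirchSwinnertonDyer.BirchSwinnertonDyer.Theses.ThetaPartnerAtTwo.MazurTateCongruenceAtTwoR := by
  refine mazurTateCongruenceAtTwoR_of_lambdaCongruence ?_
  intro W _ _ A _ _ hcm hr hss ha hAcm hAss hAa he γ hγ _ f hf ϖ hϖ Lplus Lminus hPP _ fA hfA ϖA hϖA LplusA LminusA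
    hPPA S₀ hS2 hSW hSA G m hG GA m' hGA
  obtain ⟨u₀, q, hq⟩ := hV W A hcm hr hss ha hAcm hAss hAa he γ hγ f hf Lplus Lminus hPP fA hfA LplusA LminusA hPPA
    S₀ hS2 hSW hSA
  exact lambda_congruence_two_of_flat_congruence (SSMazurTate.norm_periodRatio_eq_one_two W h2 hss hf hϖ)
    (SSMazurTate.norm_periodRatio_eq_one_two A h2 hAss hfA hϖA) hG hGA hq

/-- **(V2♭) from the crux and the PUB period-unit fact at `2`, class level.** For every theta pair, cyclotomic variable,
newforms `f, f_A` with Pollack pairs at `2` and admissible `S₀`: the `S₀`-depleted Kobayashi-plus `2`-adic `L`-functions of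
`f` and `f_A`, each in its own `Ω⁺`-normalisation, are congruent modulo `2Λ` up to a `2`-adic unit. (The period ratios
`ϖ = u_W⁻¹`, `ϖ_A = u_A⁻¹` are supplied by `h2`; the crux is tested on the unit multiples `G = ϖ̃ L♭`, `m = 0`.)
[cite: GreenbergVatsal2000, §3, (13) and Remark (3.4)] [cite: AbbesUllmo1996, Thm. A] [cite: Pollack2003, Prop. 6.18] -/
theorem flatCongruence_of_periodUnit_of_mazurTateCongruenceAtTwoR (h2 : realPeriodRat_eq_unit_mul_plusPeriod_two)
    (hMT : Summit.BirchSwinnertonDyer.BirchSwinnertonDyer.Theses.ThetaPartnerAtTwo.MazurTateCongruenceAtTwoR) :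
    ∀ (W : WeierstrassCurve ℚ) [W.IsElliptic] [W.IsGloballyMinimal] (A : WeierstrassCurve ℚ) [A.IsElliptic]
      [A.IsGloballyMinimal], ¬ W.HasCM → W.analyticRank = 0 → GoodSS W 2 → W.frobeniusTrace 2 = 0 → A.HasCM →
      GoodSS A 2 → A.frobeniusTrace 2 = 0 →
      (∃ e : WeierstrassCurve.geomTorsion W (2 : ℤ) ≃+ WeierstrassCurve.geomTorsion A (2 : ℤ),
        ∀ (σ : Field.absoluteGaloisGroup ℚ) (P : WeierstrassCurve.geomTorsion W (2 : ℤ)), e (σ • P) = σ • e P) →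
      ∀ (γ : Field.absoluteGaloisGroup ℚ), IsCyclotomicVariable 2 γ →
      ∀ [NeZero (W.conductorNorm ℤ)] (f : CuspForm (Gamma0 (W.conductorNorm ℤ)) 2), IsNewformOf W f →
      ∀ (Lplus Lminus : IwasawaAlgebra 2), IsPollackPair f 2 Lplus Lminus →
      ∀ [NeZero (A.conductorNorm ℤ)] (fA : CuspForm (Gamma0 (A.conductorNorm ℤ)) 2), IsNewformOf A fA →
      ∀ (LplusA LminusA : IwasawaAlgebra 2), IsPollackPair fA 2 LplusA LminusA →
      ∀ (S₀ : Finset (HeightOneSpectrum (𝓞 ℚ))), (∀ v ∈ S₀, ((2 : ℕ) : 𝓞 ℚ) ∉ v.asIdeal) →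
        (∀ v : HeightOneSpectrum (𝓞 ℚ), ¬ W.HasGoodReductionAt v → v ∈ S₀) →
        (∀ v : HeightOneSpectrum (𝓞 ℚ), ¬ A.HasGoodReductionAt v → v ∈ S₀) →
      ∃ (u : ℤ_[2]ˣ) (q : IwasawaAlgebra 2),
        kobayashiL 1 Lplus Lminus * eulerFactorProductInv W 2 S₀ -
            PowerSeries.C (u : ℤ_[2]) * kobayashiL 1 LplusA LminusA * eulerFactorProductInv A 2 S₀ =
          PowerSeries.C (2 : ℤ_[2]) * q := by
  intro W _ _ A _ _ hcm hr hss ha hAcm hAss hAa he γ hγ _ f hf Lplus Lminus hPP _ fA hfA LplusA LminusA hPPA S₀ hS2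
    hSW hSA
  -- period ratios from the PUB comparison `Ω = u · Ω⁺`, `|u|₂ = 1`
  obtain ⟨uW, huW, hΩW⟩ := h2 W hss.1 (Summit.BirchSwinnertonDyer.Rank1Residual.P2.irr_two_of_goodSS_two W hss) f hf
  obtain ⟨uA, huA, hΩA⟩ := h2 A hAss.1 (Summit.BirchSwinnertonDyer.Rank1Residual.P2.irr_two_of_goodSS_two A hAss) fA hfA
  obtain ⟨hϖ1, hϖ⟩ := norm_inv_eq_one_and_inv_mul_eq huW hΩW
  obtain ⟨hϖA1, hϖA⟩ := norm_inv_eq_one_and_inv_mul_eq huA hΩA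
  exact flat_congruence_two_of_lambda_congruence hϖ1 hϖA1 fun G m hG GA m' hGA ↦
    lambdaCongruence_of_mazurTateCongruenceAtTwoR hMT W A hcm hr hss ha hAcm hAss hAa he γ hγ f hf uW⁻¹ hϖ Lplus Lminus
      hPP fA hfA uA⁻¹ hϖA LplusA LminusA hPPA S₀ hS2 hSW hSA G m hG GA m' hGA

/-- **Items 25797/21416 ⟺ (V2♭), granted the PUB period-unit fact at `2`.** Under `realPeriodRat_eq_unit_mul_plusPeriod_two`
(Greenberg–Vatsal Rem. (3.4) at `p = 2`, Abbes–Ullmo), the crux `MazurTateCongruenceAtTwoR` is EQUIVALENT to the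
period-free, layer-free congruence of the `S₀`-depleted Kobayashi-plus `2`-adic `L`-functions of the two newforms:
`∃ u ∈ ℤ₂ˣ, L♭_W · E_{S₀}(W) − u · L♭_A · E_{S₀}(A) ∈ 2Λ` for every theta pair and admissible datum (Vatsal 1999 (1.10) /
Greenberg–Vatsal (13) READ AT `2` for Pollack–Sprung's `L♭`). Nothing asserted about either side.
[cite: GreenbergVatsal2000, §3, (13) and Remark (3.4)] [cite: AbbesUllmo1996, Thm. A] [cite: Vatsal1999, Thm. (1.10)]
[cite: Pollack2003, Prop. 6.18] -/
theorem mazurTateCongruenceAtTwoR_iff_flatCongruence (h2 : realPeriodRat_eq_unit_mul_plusPeriod_two) :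
    Summit.BirchSwinnertonDyer.BirchSwinnertonDyer.Theses.ThetaPartnerAtTwo.MazurTateCongruenceAtTwoR ↔
    ∀ (W : WeierstrassCurve ℚ) [W.IsElliptic] [W.IsGloballyMinimal] (A : WeierstrassCurve ℚ) [A.IsElliptic]
      [A.IsGloballyMinimal], ¬ W.HasCM → W.analyticRank = 0 → GoodSS W 2 → W.frobeniusTrace 2 = 0 → A.HasCM →
      GoodSS A 2 → A.frobeniusTrace 2 = 0 →
      (∃ e : WeierstrassCurve.geomTorsion W (2 : ℤ) ≃+ WeierstrassCurve.geomTorsion A (2 : ℤ),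
        ∀ (σ : Field.absoluteGaloisGroup ℚ) (P : WeierstrassCurve.geomTorsion W (2 : ℤ)), e (σ • P) = σ • e P) →
      ∀ (γ : Field.absoluteGaloisGroup ℚ), IsCyclotomicVariable 2 γ →
      ∀ [NeZero (W.conductorNorm ℤ)] (f : CuspForm (Gamma0 (W.conductorNorm ℤ)) 2), IsNewformOf W f →
      ∀ (Lplus Lminus : IwasawaAlgebra 2), IsPollackPair f 2 Lplus Lminus →
      ∀ [NeZero (A.conductorNorm ℤ)] (fA : CuspForm (Gamma0 (A.conductorNorm ℤ)) 2), IsNewformOf A fA →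
      ∀ (LplusA LminusA : IwasawaAlgebra 2), IsPollackPair fA 2 LplusA LminusA →
      ∀ (S₀ : Finset (HeightOneSpectrum (𝓞 ℚ))), (∀ v ∈ S₀, ((2 : ℕ) : 𝓞 ℚ) ∉ v.asIdeal) →
        (∀ v : HeightOneSpectrum (𝓞 ℚ), ¬ W.HasGoodReductionAt v → v ∈ S₀) →
        (∀ v : HeightOneSpectrum (𝓞 ℚ), ¬ A.HasGoodReductionAt v → v ∈ S₀) →
      ∃ (u : ℤ_[2]ˣ) (q : IwasawaAlgebra 2),
        kobayashiL 1 Lplus Lminus * eulerFactorProductInv W 2 S₀ -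
            PowerSeries.C (u : ℤ_[2]) * kobayashiL 1 LplusA LminusA * eulerFactorProductInv A 2 S₀ =
          PowerSeries.C (2 : ℤ_[2]) * q :=
  ⟨flatCongruence_of_periodUnit_of_mazurTateCongruenceAtTwoR h2, mazurTateCongruenceAtTwoR_of_periodUnit_of_flatCongruence h2⟩

end Flat

section UnitFree

/-- **Items 25797/21416 ⟺ the UNIT-FREE, period-free, layer-free congruence, granted the PUB period-unit fact at `2`.**
Since every `2`-adic unit is `≡ 1 (mod 2)` (`exists_units_sub_eq_C_two_mul_iff`), the unit `u` of (V2♭) is inert too: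
under `realPeriodRat_eq_unit_mul_plusPeriod_two` the crux `MazurTateCongruenceAtTwoR` is EQUIVALENT to
`L♭_W · E^ι_{S₀}(W) − L♭_A · E^ι_{S₀}(A) ∈ 2Λ` for every theta pair, newforms, Pollack pairs at `2` and admissible `S₀`
(by `flat_congruence_iff_of_admissible` the choice of the admissible `S₀` is immaterial as well). This is the research
content of the K1 row in its barest form: the `S₀`-depleted Kobayashi-plus `2`-adic `L`-functions of two weight-`2` newforms
with isomorphic (irreducible, supersingular-at-`2`) mod-`2` representations are CONGRUENT mod `2` (Vatsal 1999 (1.10) /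
Greenberg–Vatsal (13) at `p = 2`). Nothing asserted. [cite: GreenbergVatsal2000, §3, (13) and Remark (3.4)]
[cite: Vatsal1999, Thm. (1.10)] [cite: AbbesUllmo1996, Thm. A] [cite: Pollack2003, Prop. 6.18] -/
theorem mazurTateCongruenceAtTwoR_iff_sub_mem_two (h2 : realPeriodRat_eq_unit_mul_plusPeriod_two) :
    Summit.BirchSwinnertonDyer.BirchSwinnertonDyer.Theses.ThetaPartnerAtTwo.MazurTateCongruenceAtTwoR ↔
    ∀ (W : WeierstrassCurve ℚ) [W.IsElliptic] [W.IsGloballyMinimal] (A : WeierstrassCurve ℚ) [A.IsElliptic]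
      [A.IsGloballyMinimal], ¬ W.HasCM → W.analyticRank = 0 → GoodSS W 2 → W.frobeniusTrace 2 = 0 → A.HasCM →
      GoodSS A 2 → A.frobeniusTrace 2 = 0 →
      (∃ e : WeierstrassCurve.geomTorsion W (2 : ℤ) ≃+ WeierstrassCurve.geomTorsion A (2 : ℤ),
        ∀ (σ : Field.absoluteGaloisGroup ℚ) (P : WeierstrassCurve.geomTorsion W (2 : ℤ)), e (σ • P) = σ • e P) →
      ∀ (γ : Field.absoluteGaloisGroup ℚ), IsCyclotomicVariable 2 γ →
      ∀ [NeZero (W.conductorNorm ℤ)] (f : CuspForm (Gamma0 (W.conductorNorm ℤ)) 2), IsNewformOf W f →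
      ∀ (Lplus Lminus : IwasawaAlgebra 2), IsPollackPair f 2 Lplus Lminus →
      ∀ [NeZero (A.conductorNorm ℤ)] (fA : CuspForm (Gamma0 (A.conductorNorm ℤ)) 2), IsNewformOf A fA →
      ∀ (LplusA LminusA : IwasawaAlgebra 2), IsPollackPair fA 2 LplusA LminusA →
      ∀ (S₀ : Finset (HeightOneSpectrum (𝓞 ℚ))), (∀ v ∈ S₀, ((2 : ℕ) : 𝓞 ℚ) ∉ v.asIdeal) →
        (∀ v : HeightOneSpectrum (𝓞 ℚ), ¬ W.HasGoodReductionAt v → v ∈ S₀) →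
        (∀ v : HeightOneSpectrum (𝓞 ℚ), ¬ A.HasGoodReductionAt v → v ∈ S₀) →
      ∃ q : IwasawaAlgebra 2,
        kobayashiL 1 Lplus Lminus * eulerFactorProductInv W 2 S₀ -
            kobayashiL 1 LplusA LminusA * eulerFactorProductInv A 2 S₀ = PowerSeries.C (2 : ℤ_[2]) * q := by
  rw [mazurTateCongruenceAtTwoR_iff_flatCongruence h2]
  constructor
  · intro h W _ _ A _ _ hcm hr hss ha hAcm hAss hAa he γ hγ _ f hf Lplus Lminus hPP _ fA hfA LplusA LminusA hPPA S₀
      hS2 hSW hSA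
    exact (exists_units_sub_eq_C_two_mul_iff _ _ _).mp
      (h W A hcm hr hss ha hAcm hAss hAa he γ hγ f hf Lplus Lminus hPP fA hfA LplusA LminusA hPPA S₀ hS2 hSW hSA)
  · intro h W _ _ A _ _ hcm hr hss ha hAcm hAss hAa he γ hγ _ f hf Lplus Lminus hPP _ fA hfA LplusA LminusA hPPA S₀
      hS2 hSW hSA
    exact (exists_units_sub_eq_C_two_mul_iff _ _ _).mpr
      (h W A hcm hr hss ha hAcm hAss hAa he γ hγ f hf Lplus Lminus hPP fA hfA LplusA LminusA hPPA S₀ hS2 hSW hSA)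

end UnitFree

/-! ## Appended by the same seat: the crux ⟺ the CENSUS CURRENCY at all even layers -/

section CensusClass

/-- **Items 25797/21416 ⟺ the census currency, granted the PUB period-unit fact at `2`.** Under
`realPeriodRat_eq_unit_mul_plusPeriod_two`, the crux `MazurTateCongruenceAtTwoR` is EQUIVALENT to: for every theta pair,
newforms `f, f_A` with Pollack pairs at `2`, admissible `S₀` and EVERY EVEN layer `n`, the `Ω⁺`-normalised `S₀`-depleted
Mazur–Tate elements are congruent modulo `(2, ω_n)` with unit `1`:
`θ_n(f)·ιE^ι_{S₀}(W) − θ_n(f_A)·ιE^ι_{S₀}(A) ∈ ι(2Λ + ω_nΛ)` — exactly what the cell's falsifier runs test layer by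
layer (FALSIFIER-V2MT-SPEC-v1; modulo `2` the odd Néron period ratios are `≡ 1`). So ONE incongruent even layer refutes the
crux, and congruence at all even layers proves it (both modulo the PUB fact). [cite: GreenbergVatsal2000, §3, (13)]
[cite: Pollack2003, Prop. 6.18] [cite: AbbesUllmo1996, Thm. A] -/
theorem mazurTateCongruenceAtTwoR_iff_forall_even_layer_sub (h2 : realPeriodRat_eq_unit_mul_plusPeriod_two) :
    Summit.BirchSwinnertonDyer.BirchSwinnertonDyer.Theses.ThetaPartnerAtTwo.MazurTateCongruenceAtTwoR ↔
    ∀ (W : WeierstrassCurve ℚ) [W.IsElliptic] [W.IsGloballyMinimal] (A : WeierstrassCurve ℚ) [A.IsElliptic]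
      [A.IsGloballyMinimal], ¬ W.HasCM → W.analyticRank = 0 → GoodSS W 2 → W.frobeniusTrace 2 = 0 → A.HasCM →
      GoodSS A 2 → A.frobeniusTrace 2 = 0 →
      (∃ e : WeierstrassCurve.geomTorsion W (2 : ℤ) ≃+ WeierstrassCurve.geomTorsion A (2 : ℤ),
        ∀ (σ : Field.absoluteGaloisGroup ℚ) (P : WeierstrassCurve.geomTorsion W (2 : ℤ)), e (σ • P) = σ • e P) →
      ∀ (γ : Field.absoluteGaloisGroup ℚ), IsCyclotomicVariable 2 γ →
      ∀ [NeZero (W.conductorNorm ℤ)] (f : CuspForm (Gamma0 (W.conductorNorm ℤ)) 2), IsNewformOf W f →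
      ∀ (Lplus Lminus : IwasawaAlgebra 2), IsPollackPair f 2 Lplus Lminus →
      ∀ [NeZero (A.conductorNorm ℤ)] (fA : CuspForm (Gamma0 (A.conductorNorm ℤ)) 2), IsNewformOf A fA →
      ∀ (LplusA LminusA : IwasawaAlgebra 2), IsPollackPair fA 2 LplusA LminusA →
      ∀ (S₀ : Finset (HeightOneSpectrum (𝓞 ℚ))), (∀ v ∈ S₀, ((2 : ℕ) : 𝓞 ℚ) ∉ v.asIdeal) →
        (∀ v : HeightOneSpectrum (𝓞 ℚ), ¬ W.HasGoodReductionAt v → v ∈ S₀) →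
        (∀ v : HeightOneSpectrum (𝓞 ℚ), ¬ A.HasGoodReductionAt v → v ∈ S₀) →
      ∀ n : ℕ, Even n → ∃ q r : IwasawaAlgebra 2,
        ((mazurTateElement f 2 n).map (algebraMap ℚ ℚ_[2]) : PowerSeries ℚ_[2]) *
              iwasawaToPowerSeries 2 (eulerFactorProductInv W 2 S₀) -
            ((mazurTateElement fA 2 n).map (algebraMap ℚ ℚ_[2]) : PowerSeries ℚ_[2]) *
              iwasawaToPowerSeries 2 (eulerFactorProductInv A 2 S₀) =
          iwasawaToPowerSeries 2 (PowerSeries.C (2 : ℤ_[2]) * q + toIwasawa 2 (cyclotomicOmega 2 n) * r) := by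
  rw [mazurTateCongruenceAtTwoR_iff_sub_mem_two h2]
  constructor
  · intro h W _ _ A _ _ hcm hr hss ha hAcm hAss hAa he γ hγ _ f hf Lplus Lminus hPP _ fA hfA LplusA LminusA hPPA S₀
      hS2 hSW hSA
    have hK : kobayashiL (1 : ℤˣ) Lplus Lminus = Lminus := if_pos rfl
    have hKA : kobayashiL (1 : ℤˣ) LplusA LminusA = LminusA := if_pos rfl
    have h' := h W A hcm hr hss ha hAcm hAss hAa he γ hγ f hf Lplus Lminus hPP fA hfA LplusA LminusA hPPA S₀ hS2 hSW hSA
    rw [hK, hKA] at h'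
    exact (forall_even_layer_sub_iff_sub f fA hPP hPPA _ _).mpr h'
  · intro h W _ _ A _ _ hcm hr hss ha hAcm hAss hAa he γ hγ _ f hf Lplus Lminus hPP _ fA hfA LplusA LminusA hPPA S₀
      hS2 hSW hSA
    have hK : kobayashiL (1 : ℤˣ) Lplus Lminus = Lminus := if_pos rfl
    have hKA : kobayashiL (1 : ℤˣ) LplusA LminusA = LminusA := if_pos rfl
    rw [hK, hKA]
    exact (forall_even_layer_sub_iff_sub f fA hPP hPPA _ _).mp
      (h W A hcm hr hss ha hAcm hAss hAa he γ hγ f hf Lplus Lminus hPP fA hfA LplusA LminusA hPPA S₀ hS2 hSW hSA)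

end CensusClass

end Summit.BirchSwinnertonDyer.BirchSwinnertonDyer.Theorems.MazurTateCongruenceAtTwoR

end
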